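import Summits.Ventures.GridStability.Lyapunov.NE39LossySplitLinesLPCert
import Summits.Ventures.GridStability.Bench.NE39LossySplitLinesLPRoaData
import Summits.Ventures.GridStability.Models.ClassicalSwingGlobal
import Literature.Computation.Certificates.RankOneSolveCertificate
import HarnessLib

/-!
# «NE39-LOSSY-SPLITU» — the positivity certificate's REGION on the lossy 39-bus 10-machine Kron model at `2·arctan(1/100)`
# (≈ 1.146°): rank-one level by ONE linear solve, ROA sentence, synchronisation, well-posedness, certified inner ball

Cell `gridfusion` (LADDER-GRIDFUSION G2.c lossy Lur'e tier, 39-bus rung); seat gridfusion-lit-6 (g10).  The certificate files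
(`Lyapunov/NE39LossySplitLinesLPCert*.lean`) typed `lpCert : LPSlabCertificate NE39.splitLurieLinesSystem` (Schur form) and its
sector hypothesis `hsecL`.  HERE (the ★ #146 / «#156-cand» recipe on the third system, with one new device):

* `rankOneL` — rank-one facts `s_k·(P + Cᵀdiag(λa)C) − C_kᵀC_k ⪰ 0` for all 200 channels, NOT by 200 kernel `LDLᵀ` but by
  lit-6's LINEAR-SOLVE CERTIFICATE (`Literature/Computation/Certificates/RankOneSolveCertificate.lean`, Horn–Johnson Thm 7.7.7
  one-sided / Cauchy–Schwarz): `lowlit ⪰ 0` (`low_ldl`), the exact solve `lowlit·W = [0; 1]` on the nine angle columns decided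
  ONCE (`low_mul_W`), `C_k = [0; 1]·C_k^θ` (`sel_mulVec`), `s_k ≥ C_k·(W C_k^θ)` (`sL_solve`);
* the level `c_rk = 14995498147/1000000000000000` (≈ 1.500e-05), `c_rk·s_k ≤ γ_lo²`, `γ_lo = 200/10001 = sin γ < γ` (`gloLQ_lt_gamma`) ⇒ `hlevL`;
* **`lossy_splitLinesLP_slab_roa`** — for MODEL M = `NE39.preLossless.toModelRel (1/10) 0`: every solution on `ℝ` whose initial
  Lur'e state lies in the open slab `γ = 2·arctan(1/100)` (every `|(δ_p − δ_q) − (θ*_p − θ*_q)| < γ`, `mem_slab_iff`) with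
  `V_LP ≤ lev ≤ c_rk` keeps both for all `t ≥ 0` and its Lur'e state tends to `0` (lit-6
  `LPSlabCertificate.well_subset_regionOfAttraction_of_rankOne` + the hypothesis-free bridge `NE39.hasDerivWithinAt_lurieState_lines`);
  `_sync` (machine coordinates), `_wellPosed` (∃! solution, model-1's `ClassicalSwing.exists_isSolutionOn_univ` / `isSolutionOn_univ_unique`);
* the CERTIFIED INNER BALL: `t·1 − (P + Cᵀdiag(λb)C) ⪰ 0`, `t = 133/512` (`upper_ldl` on the table `uplit`, re-decided entrywise
  `uplit_eq`), `ϱ = 57727030459/1000000000000000` (`ball_tests`), `|C_k|² ≤ 2` ⇒ `{x : xᵀx ≤ ϱ} ⊆ lpCert.well γ c_rk` (`ball_subset_wellL`),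
  `lossy_splitLinesLP_ball_roa`: certified Lur'e-state radius `√ϱ ≈ 0.00760` (ten speeds + nine MACHINE angles relative to machine 0).

THREE COLUMNS.  CERTIFIED for MODEL M, CLASS = the well `{slab 2·arctan(1/100), V_LP ≤ lev}` ∪ the ball — an INNER ROA estimate of
the model's synchronous equilibrium, a priori over all solutions; the window `1.146°` is a certificate-class datum (VALIDATED float
bracket: positivity class feasible at `u ≤ 3/200`, class of record at `u ≤ 1/100`, both infeasible at `1/50`; kit j292614 / j293727), not a
stability margin of any grid.  MODELLED: model-4's NE39 lossy Kron record (`NE39.preLossless`: 39-bus data reduced to the 10 internal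
nodes WITH transfer conductances; ASSUMED uniform damping `λ = 1/10`, `a′ = 0`; `θ* = preLossless.angleOf`).  VALIDATED: producer
lineage (certificate files).  Nothing here says the 39-bus system or a grid is stable.
[cite: Pai1981, §2.16 Theorem [18] eqs. (2.63)–(2.64), §3.6.3 eqs. (3.43)–(3.45); Khalil2002, §7.1.2 Theorem 7.3, §4.8 Theorem 4.10; VuTuritsyn2017, §4.3 Theorem 1; HornJohnson2013, Thm 7.7.7]
-/

noncomputable section

open Real Set Filter Topology Matrix
open Literature.Computation.Certificates
open Literature.MathematicalPhysics.PowerSystems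
open Literature.MathematicalPhysics.PowerSystems.LyapunovFunctionFamily
open Summit.Ventures.GridStability.Models
open Summit.Ventures.GridStability.Lyapunov.NE39LossySplitLines (e1 AQ CQ BLQ A_eq C_eq)
open Summit.Ventures.GridStability.Lyapunov.NE39LossySplitLinesLPCert (PL lamL aL bL lowlit uplit lowlit_eq lpCert lpCert_a_b hsecL cos_sin_γL)

namespace Summit.Ventures.GridStability.Bench.NE39LossySplitLinesLPRoa

/-! ### Rank-one constants, level, lower matrix -/

/-- Half-tangent of the window: `u = 1/100`. -/
def uLQ : ℚ := 1 / 100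
/-- Inner rational width `γ_lo = 200/10001` (`= sin γ ≤ γ`). -/
def gloLQ : ℚ := 200/10001
/-- `s` on the typed channel index. -/
def sL (k : ((Fin 10 × Fin 10) ⊕ (Fin 10 × Fin 10))) : ℚ := Sum.elim (fun pq : Fin 10 × Fin 10 => sTab 0 pq.1 pq.2) (fun pq => sTab 1 pq.1 pq.2) k
/-- The rank-one level `c_rk = 14995498147/1000000000000000`. -/
def cRkLQ : ℚ := 14995498147/1000000000000000

/-- The lower matrix `P + Cᵀ·diag(λa)·C` over `ℚ` on the typed index (formula). -/
def lowerPQ : Matrix (Fin 10 ⊕ Fin 9) (Fin 10 ⊕ Fin 9) ℚ := PL + CQᵀ * Matrix.diagonal (fun k => lamL k * aL k) * CQ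

/-- `0 ≤ γ_lo`, `γ_lo²(1 + u²) ≤ 4u²` (i.e. `γ_lo ≤ sin γ`), `0 < u` (kernel arithmetic). -/
theorem gloL_test : 0 ≤ gloLQ ∧ gloLQ ^ 2 * (1 + uLQ ^ 2) ≤ 4 * uLQ ^ 2 ∧ 0 < uLQ := by
  refine ⟨by norm_num [gloLQ], by norm_num [gloLQ, uLQ], by norm_num [uLQ]⟩
/-- `0 < c_rk`. -/
theorem cRkLQ_pos : 0 < cRkLQ := by norm_num [cRkLQ]

/-- The level tests `0 < s_k` and `c_rk·s_k ≤ γ_lo²` on every channel (kernel). -/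
theorem sL_tests : ∀ k : ((Fin 10 × Fin 10) ⊕ (Fin 10 × Fin 10)), 0 < sL k ∧ cRkLQ * sL k ≤ gloLQ ^ 2 := by
  decide +kernel

/-- `(Cᵀ·diag f·C) i j = Σ_k C_ki f_k C_kj` (plumbing). -/
private theorem tDt_apply (f : ((Fin 10 × Fin 10) ⊕ (Fin 10 × Fin 10)) → ℚ) (i j : Fin 10 ⊕ Fin 9) :
    (CQᵀ * Matrix.diagonal f * CQ) i j = ∑ k, CQ k i * f k * CQ k j := by
  rw [Matrix.mul_apply]; simp only [Matrix.mul_diagonal, Matrix.transpose_apply]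

/-- **The lower matrix formula IS the table** (typed; via file 1's entrywise re-decision `lowlit_eq`). -/
theorem lowerPQ_eq_F : lowerPQ = lowlit.submatrix e1 e1 := by
  ext i j
  have h := lowlit_eq i j
  simp only [Lyapunov.NE39LossySplitLinesLPCert.lowF] at h
  rw [Matrix.submatrix_apply, h, lowerPQ, Matrix.add_apply, tDt_apply]
  simp only [Fintype.sum_sum_type, Fintype.sum_prod_type]

/-! ### The linear-solve rank-one certificate (kernel) -/

/-- The solve on the typed state index. -/
def WT : Matrix (Fin 10 ⊕ Fin 9) (Fin 9) ℚ := fun i a => W19 (e1 i) a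
/-- The right-hand sides `[0; 1]`: the nine angle coordinates. -/
def selT : Matrix (Fin 10 ⊕ Fin 9) (Fin 9) ℚ := fun i a => Sum.elim (fun _ => 0) (fun a' : Fin 9 => if a' = a then 1 else 0) i
/-- The angle part of channel `k`'s row of `C`. -/
def uθ (k : ((Fin 10 × Fin 10) ⊕ (Fin 10 × Fin 10))) : Fin 9 → ℚ := fun a => CQ k (Sum.inr a)

set_option maxHeartbeats 4000000 in
/-- **The solve is EXACT**: `lowlit·W = [0; 1]` (kernel, 19 × 9 rational identities). -/
theorem low_mul_W : lowlit.submatrix e1 e1 * WT = selT := by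
  decide +kernel

/-- `C_k = [0; 1]·C_k^θ` for every channel (kernel). -/
theorem sel_mulVec : ∀ k : ((Fin 10 × Fin 10) ⊕ (Fin 10 × Fin 10)), selT *ᵥ uθ k = CQ k := by
  decide +kernel

set_option maxHeartbeats 4000000 in
/-- **`s_k ≥ C_k·(W·C_k^θ)`** (`= C_k L⁻¹ C_kᵀ`) for every channel (kernel). -/
theorem sL_solve : ∀ k : ((Fin 10 × Fin 10) ⊕ (Fin 10 × Fin 10)), CQ k ⬝ᵥ WT *ᵥ uθ k ≤ sL k := by
  decide +kernel

set_option maxHeartbeats 4000000 in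
/-- `P + Cᵀdiag(λa)C ⪰ 0` itself (19 × 19 kernel `LDLᵀ` on the table). -/
theorem low_ldl : PSD.LDLCert lowlit := by
  decide +kernel

/-- `γ_lo < 2·arctan(1/100)`: `γ_lo = sin(2·arctan u) = 2u/(1+u²) < 2·arctan u`. -/
theorem gloLQ_lt_gamma : ((gloLQ : ℚ) : ℝ) < 2 * Real.arctan (1 / 100 : ℝ) := by
  have hsin : Real.sin (2 * Real.arctan (1 / 100 : ℝ)) = ((200/10001 : ℚ) : ℝ) := cos_sin_γL.2
  have hle : ((gloLQ : ℚ) : ℝ) ≤ ((200/10001 : ℚ) : ℝ) := by norm_num [gloLQ]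
  have hpos : 0 < 2 * Real.arctan (1 / 100 : ℝ) := by
    have := Real.arctan_pos.2 (show (0 : ℝ) < 1 / 100 by norm_num)
    linarith
  have hlt : Real.sin (2 * Real.arctan (1 / 100 : ℝ)) < 2 * Real.arctan (1 / 100 : ℝ) := Real.sin_lt hpos
  linarith

/-! ### Cast plumbing -/

/-- `(M·N) ↦ ℝ` (plumbing). -/
private theorem map_mul' {m n o : Type*} [Fintype n] (M : Matrix m n ℚ) (N : Matrix n o ℚ) :
    (M * N).map (Rat.cast : ℚ → ℝ) = M.map (Rat.cast : ℚ → ℝ) * N.map (Rat.cast : ℚ → ℝ) :=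
  Matrix.map_mul (f := Rat.castHom ℝ)
/-- `(M + N) ↦ ℝ` (plumbing). -/
private theorem map_add' {m n : Type*} (M N : Matrix m n ℚ) :
    (M + N).map (Rat.cast : ℚ → ℝ) = M.map (Rat.cast : ℚ → ℝ) + N.map (Rat.cast : ℚ → ℝ) := by
  ext; simp
/-- `Mᵀ ↦ ℝ` (plumbing). -/
private theorem map_transpose' {m n : Type*} (M : Matrix m n ℚ) :
    Mᵀ.map (Rat.cast : ℚ → ℝ) = (M.map (Rat.cast : ℚ → ℝ))ᵀ := by
  ext; simp
/-- `diagonal d ↦ ℝ` (plumbing). -/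
private theorem map_diagonal' {n : Type*} [DecidableEq n] (d : n → ℚ) :
    (Matrix.diagonal d).map (Rat.cast : ℚ → ℝ) = Matrix.diagonal (fun i => ((d i : ℚ) : ℝ)) :=
  Matrix.diagonal_map (Rat.cast_zero)

/-- **The certificate's lower matrix is the cast of `lowerPQ`.** -/
theorem lowerMatrix_eq : lpCert.lowerMatrix = lowerPQ.map (Rat.cast : ℚ → ℝ) := by
  have hd : Matrix.diagonal (fun k => lpCert.lam k * lpCert.a k)
      = (Matrix.diagonal (fun k => lamL k * aL k)).map (Rat.cast : ℚ → ℝ) := by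
    rw [map_diagonal']
    congr 1; funext k
    show ((lamL k : ℚ) : ℝ) * ((aL k : ℚ) : ℝ) = _
    push_cast; rfl
  rw [LPSlabCertificate.lowerMatrix, C_eq, hd, lowerPQ]
  show PL.map (Rat.cast : ℚ → ℝ) + _ = _
  simp only [map_add', map_mul', map_transpose']

/-- `lowlit ⪰ 0` over `ℝ` on the typed index. -/
private theorem low_psd : ((lowlit.submatrix e1 e1).map (Rat.cast : ℚ → ℝ)).PosSemidef :=
  (low_ldl.posSemidef (R := ℝ)).submatrix e1

/-- **Rank-one facts** `s_k·lowerMatrix − C_kᵀC_k ⪰ 0` for every channel — by the linear-solve certificate.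
[cite: HornJohnson2013, Thm 7.7.7; VuTuritsyn2017, §4.3 Theorem 1 (eq. V_min); Khalil2002, §7.1.2 Theorem 7.3] -/
theorem rankOneL (k : ((Fin 10 × Fin 10) ⊕ (Fin 10 × Fin 10))) :
    (((sL k : ℚ) : ℝ) • lpCert.lowerMatrix
      - Matrix.vecMulVec (NE39.splitLurieLinesSystem.C k) (NE39.splitLurieLinesSystem.C k)).PosSemidef := by
  have hC : NE39.splitLurieLinesSystem.C k = fun i => ((CQ k i : ℚ) : ℝ) := by
    rw [C_eq]; rfl
  rw [hC, lowerMatrix_eq, lowerPQ_eq_F]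
  exact posSemidef_map_smul_sub_vecMulVec_of_mul_eq low_psd low_mul_W (uθ k) (sel_mulVec k) (sL_solve k)

/-- `0 < s_k` (real). -/
theorem sL_pos (k : ((Fin 10 × Fin 10) ⊕ (Fin 10 × Fin 10))) : (0 : ℝ) < ((sL k : ℚ) : ℝ) := by
  exact_mod_cast (sL_tests k).1

/-- **Level hypothesis**: every `lev ≤ c_rk` satisfies `lev < γ²/s_k` on every channel (`c_rk·s_k ≤ γ_lo² < γ²`). -/
theorem hlevL {lev : ℝ} (hle : lev ≤ ((cRkLQ : ℚ) : ℝ)) (k : ((Fin 10 × Fin 10) ⊕ (Fin 10 × Fin 10))) :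
    lev < (2 * Real.arctan (1 / 100 : ℝ)) ^ 2 / ((sL k : ℚ) : ℝ) := by
  have hs := sL_pos k
  have ht : ((cRkLQ : ℚ) : ℝ) * ((sL k : ℚ) : ℝ) ≤ ((gloLQ : ℚ) : ℝ) ^ 2 := by
    exact_mod_cast (sL_tests k).2
  have hg0 : (0 : ℝ) ≤ ((gloLQ : ℚ) : ℝ) := by exact_mod_cast gloL_test.1
  have hg := gloLQ_lt_gamma
  have hsq : ((gloLQ : ℚ) : ℝ) ^ 2 < (2 * Real.arctan (1 / 100 : ℝ)) ^ 2 := by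
    exact pow_lt_pow_left₀ hg hg0 two_ne_zero
  rw [lt_div_iff₀ hs]
  nlinarith

/-! ### The slab in machine coordinates -/

/-- The relative angle coordinates of the Lur'e state, extended by `0` at the reference machine (plumbing). -/
private theorem ext0_lurieState (z : ClassicalSwing.State 10) (p : Fin 10) :
    InternalNode.ext0 ((NE39.preLossless.lurieState NE39.preLossless.angleOf z) ∘ Sum.inr) p = (z.1 p - z.1 0) - (NE39.preLossless.angleOf p - NE39.preLossless.angleOf 0) := by
  rw [RecastData.lurieState_eq]
  cases p using Fin.cases with
  | zero => simp
  | succ a => simp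

/-- **Channel values of the Lur'e state**: channel `inl (p,q)` / `inr (p,q)` reads the machine-angle-difference
deviation `(δ_p − δ_q) − (θ*_p − θ*_q)`. -/
theorem channel_lurieState (z : ClassicalSwing.State 10) (k : ((Fin 10 × Fin 10) ⊕ (Fin 10 × Fin 10))) :
    (NE39.splitLurieLinesSystem.C *ᵥ NE39.preLossless.lurieState NE39.preLossless.angleOf z) k
      = (z.1 (Sum.elim id id k).1 - z.1 (Sum.elim id id k).2)
        - (NE39.preLossless.angleOf (Sum.elim id id k).1 - NE39.preLossless.angleOf (Sum.elim id id k).2) := by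
  rw [show NE39.splitLurieLinesSystem = System.machineReference _ _ _ _ _ from rfl, System.machineReference_C_mulVec,
    InternalNode.fromRows_pairIncidence_mulVec]
  rcases k with k | k
  · rw [Sum.elim_inl, InternalNode.pairIncidence_mulVec, ext0_lurieState, ext0_lurieState]
    simp only [Sum.elim_inl, id]
    ring
  · rw [Sum.elim_inr, InternalNode.pairIncidence_mulVec, ext0_lurieState, ext0_lurieState]
    simp only [Sum.elim_inr, id]
    ring

/-- **The slab in machine-angle terms**: the Lur'e state of `z = (δ, ω)` lies in the open slab `γ` of `NE39.splitLurieLinesSystem` iff every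
machine-angle-difference deviation satisfies `|(δ_p − δ_q) − (θ*_p − θ*_q)| < γ`. -/
theorem mem_slab_iff (z : ClassicalSwing.State 10) (γ : ℝ) :
    NE39.preLossless.lurieState NE39.preLossless.angleOf z ∈ NE39.splitLurieLinesSystem.slab (fun _ => γ) ↔
      ∀ p q : Fin 10, |(z.1 p - z.1 q) - (NE39.preLossless.angleOf p - NE39.preLossless.angleOf q)| < γ := by
  simp only [System.slab, Set.mem_setOf_eq, channel_lurieState]
  constructor
  · intro h p q
    exact h (Sum.inl (p, q))
  · rintro h (⟨p, q⟩ | ⟨p, q⟩) <;> exact h p q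

/-! ### THE SENTENCE -/

/-- **«NE39-LOSSY-SPLITU» — the certified region of the lossy 39-bus 10-machine Kron model at the window `2·arctan(1/100)`
(≈ 1.146°), Lur'e–Postnikov POSITIVITY certificate (Schur form) on the UNORDERED-LINES split presentation.**  For MODEL
M = `NE39.preLossless.toModelRel (1/10) 0` (New-England 39-bus data Kron-reduced to the ten machine internal nodes WITH transfer
conductances, uniform damping ratio `1/10`, equilibrium `θ* = preLossless.angleOf`): every solution `c` on `ℝ` whose initial Lur'e
state lies in the open slab `γ = 2·arctan(1/100)` (every `|(δ_p − δ_q) − (θ*_p − θ*_q)| < γ`, `mem_slab_iff`) and has `V_LP ≤ lev` for a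
level `lev ≤ c_rk = 14995498147/1000000000000000` (`V_LP = xᵀPx + 2Σ_k λ_k∫₀^{y_k}F_k` of `lpCert`) keeps BOTH for all `t ≥ 0`, and its Lur'e
state tends to `0`.  CERTIFIED for MODEL M, CLASS = the well (inner ROA estimate, a priori over all solutions); MODELLED as model-4's
record; nothing here says the 39-bus system is stable.
[cite: Pai1981, §2.16 Theorem [18] eqs. (2.63)–(2.64), §3.6.3 eqs. (3.43)–(3.45); Khalil2002, §7.1.2 Theorem 7.3] -/
theorem lossy_splitLinesLP_slab_roa {lev : ℝ} (hle : lev ≤ ((cRkLQ : ℚ) : ℝ))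
    {c : ℝ → ClassicalSwing.State 10} (hc : (NE39.preLossless.toModelRel (1 / 10) 0).IsSolutionOn c univ)
    (h0 : NE39.preLossless.lurieState NE39.preLossless.angleOf (c 0) ∈ NE39.splitLurieLinesSystem.slab (fun _ => 2 * Real.arctan (1 / 100 : ℝ)))
    (h0c : lpCert.V (NE39.preLossless.lurieState NE39.preLossless.angleOf (c 0)) ≤ lev) :
    (∀ t, 0 ≤ t →
        NE39.preLossless.lurieState NE39.preLossless.angleOf (c t) ∈ NE39.splitLurieLinesSystem.slab (fun _ => 2 * Real.arctan (1 / 100 : ℝ)) ∧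
          lpCert.V (NE39.preLossless.lurieState NE39.preLossless.angleOf (c t)) ≤ lev) ∧
      Tendsto (fun t => NE39.preLossless.lurieState NE39.preLossless.angleOf (c t)) atTop (𝓝 0) := by
  have key := lpCert.well_subset_regionOfAttraction_of_rankOne (γ := fun _ => 2 * Real.arctan (1 / 100 : ℝ)) hsecL
    (fun k => sL_pos k) rankOneL (hlevL hle) (y := NE39.preLossless.lurieState NE39.preLossless.angleOf (c 0)) ⟨h0, h0c⟩
  have h2 := key.2 (fun t => NE39.preLossless.lurieState NE39.preLossless.angleOf (c t)) rfl
    fun T t _ => NE39.hasDerivWithinAt_lurieState_lines hc t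
  exact ⟨fun t ht => ⟨(h2.1 t ht).1, (h2.1 t ht).2⟩, h2.2⟩

/-- **The same, read in machine coordinates (synchronisation).** For all `t ≥ 0` every machine-angle-difference deviation stays
`< 2·arctan(1/100)`; every speed deviation `ω_i(t) → 0`; every relative angle `δ_{a+1}(t) − δ_0(t) → θ*_{a+1} − θ*_0`.  MODELLED as
model-4's record; nothing here says the 39-bus system is stable. [cite: Pai1981, §3.6.3 eqs. (3.43)–(3.45); Khalil2002, §7.1.2 Theorem 7.3] -/
theorem lossy_splitLinesLP_slab_sync {lev : ℝ} (hle : lev ≤ ((cRkLQ : ℚ) : ℝ))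
    {c : ℝ → ClassicalSwing.State 10} (hc : (NE39.preLossless.toModelRel (1 / 10) 0).IsSolutionOn c univ)
    (h0 : ∀ p q : Fin 10, |((c 0).1 p - (c 0).1 q) - (NE39.preLossless.angleOf p - NE39.preLossless.angleOf q)| < 2 * Real.arctan (1 / 100 : ℝ))
    (h0c : lpCert.V (NE39.preLossless.lurieState NE39.preLossless.angleOf (c 0)) ≤ lev) :
    (∀ t, 0 ≤ t → ∀ p q : Fin 10,
        |((c t).1 p - (c t).1 q) - (NE39.preLossless.angleOf p - NE39.preLossless.angleOf q)| < 2 * Real.arctan (1 / 100 : ℝ)) ∧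
      (∀ i : Fin 10, Tendsto (fun t => (c t).2 i) atTop (𝓝 0)) ∧
      ∀ a : Fin 9, Tendsto (fun t => (c t).1 a.succ - (c t).1 0) atTop (𝓝 (NE39.preLossless.angleOf a.succ - NE39.preLossless.angleOf 0)) := by
  obtain ⟨hkeep, hlim⟩ := lossy_splitLinesLP_slab_roa hle hc ((mem_slab_iff _ _).2 h0) h0c
  have hcoord := tendsto_pi_nhds.1 hlim
  refine ⟨fun t ht => (mem_slab_iff _ _).1 (hkeep t ht).1, fun i => ?_, fun a => ?_⟩
  · have h := hcoord (Sum.inl i)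
    simp only [RecastData.lurieState_eq, Sum.elim_inl, Pi.zero_apply] at h
    exact h
  · have h := hcoord (Sum.inr a)
    simp only [RecastData.lurieState_eq, Sum.elim_inr, Pi.zero_apply] at h
    have h2 := h.add_const (NE39.preLossless.angleOf a.succ - NE39.preLossless.angleOf 0)
    simp only [zero_add, sub_add_cancel] at h2
    exact h2

/-- **Well-posed form**: for every machine state `z` with all `|(δ_p − δ_q) − (θ*_p − θ*_q)| < 2·arctan(1/100)` and
`V_LP(z) ≤ lev ≤ c_rk`: a solution of M on `ℝ` from `z` EXISTS, every solution from `z` is that one, and along it the deviations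
stay in the window with `V_LP ≤ lev`, every `ω_i(t) → 0` and every relative angle converges to its equilibrium value.  MODELLED as
model-4's record. [cite: Khalil2002, §7.1.2 Theorem 7.3; Pai1981, §3.6.3 eqs. (3.43)–(3.45)] -/
theorem lossy_splitLinesLP_slab_wellPosed {lev : ℝ} (hle : lev ≤ ((cRkLQ : ℚ) : ℝ)) (z : ClassicalSwing.State 10)
    (hz : ∀ p q : Fin 10, |(z.1 p - z.1 q) - (NE39.preLossless.angleOf p - NE39.preLossless.angleOf q)| < 2 * Real.arctan (1 / 100 : ℝ))
    (hzc : lpCert.V (NE39.preLossless.lurieState NE39.preLossless.angleOf z) ≤ lev) :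
    (∃ c : ℝ → ClassicalSwing.State 10, c 0 = z ∧ (NE39.preLossless.toModelRel (1 / 10) 0).IsSolutionOn c univ) ∧
      ∀ c : ℝ → ClassicalSwing.State 10, c 0 = z → (NE39.preLossless.toModelRel (1 / 10) 0).IsSolutionOn c univ →
        (∀ c' : ℝ → ClassicalSwing.State 10, c' 0 = z → (NE39.preLossless.toModelRel (1 / 10) 0).IsSolutionOn c' univ → c' = c) ∧
        (∀ t, 0 ≤ t →
          (∀ p q : Fin 10, |((c t).1 p - (c t).1 q) - (NE39.preLossless.angleOf p - NE39.preLossless.angleOf q)| < 2 * Real.arctan (1 / 100 : ℝ)) ∧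
            lpCert.V (NE39.preLossless.lurieState NE39.preLossless.angleOf (c t)) ≤ lev) ∧
        (∀ i : Fin 10, Tendsto (fun t => (c t).2 i) atTop (𝓝 0)) ∧
        ∀ a : Fin 9, Tendsto (fun t => (c t).1 a.succ - (c t).1 0) atTop (𝓝 (NE39.preLossless.angleOf a.succ - NE39.preLossless.angleOf 0)) := by
  refine ⟨(NE39.preLossless.toModelRel (1 / 10) 0).exists_isSolutionOn_univ z, fun c hc0 hc => ?_⟩
  have hkeep := lossy_splitLinesLP_slab_roa hle hc ((mem_slab_iff _ _).2 (hc0.symm ▸ hz)) (hc0.symm ▸ hzc)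
  have hsync := lossy_splitLinesLP_slab_sync hle hc (hc0.symm ▸ hz) (hc0.symm ▸ hzc)
  refine ⟨fun c' hc0' hc' => (NE39.preLossless.toModelRel (1 / 10) 0).isSolutionOn_univ_unique hc' hc (hc0'.trans hc0.symm), ?_,
    hsync.2.1, hsync.2.2⟩
  intro t ht
  exact ⟨hsync.1 t ht, (hkeep.1 t ht).2⟩

/-! ### The certified inner ball -/

/-- Upper constant `t = 133/512`: `t·1 − (P + Cᵀdiag(λb)C) ⪰ 0`. -/
def tUQ : ℚ := 133 / 512
/-- Squared ball radius `ϱ = 57727030459/1000000000000000` (`≈ 5.773e-05`; radius ≈ 0.00760). -/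
def rho2LQ : ℚ := 57727030459 / 1000000000000000

/-- The upper matrix `P + Cᵀ·diag(λb)·C` over `ℚ` on the typed index (formula). -/
def upperPQ : Matrix (Fin 10 ⊕ Fin 9) (Fin 10 ⊕ Fin 9) ℚ := PL + CQᵀ * Matrix.diagonal (fun k => lamL k * bL k) * CQ
/-- The tabulated upper matrix on the typed index. -/
def upF (i j : Fin 10 ⊕ Fin 9) : ℚ := uplit (e1 i) (e1 j)

set_option maxHeartbeats 4000000 in
/-- **`uplit` is `P + Cᵀdiag(λb)C`** entrywise (kernel). -/
theorem uplit_eq : ∀ i j : Fin 10 ⊕ Fin 9, upF i j =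
    PL i j + ((∑ p : Fin 10, ∑ q : Fin 10, CQ (Sum.inl (p, q)) i * (lamL (Sum.inl (p, q)) * bL (Sum.inl (p, q))) * CQ (Sum.inl (p, q)) j)
        + (∑ p : Fin 10, ∑ q : Fin 10, CQ (Sum.inr (p, q)) i * (lamL (Sum.inr (p, q)) * bL (Sum.inr (p, q))) * CQ (Sum.inr (p, q)) j)) := by
  decide +kernel

/-- **The upper matrix formula IS the table** (typed). -/
theorem upperPQ_eq_F : upperPQ = uplit.submatrix e1 e1 := by
  ext i j
  have h := uplit_eq i j
  simp only [upF] at h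
  rw [Matrix.submatrix_apply, h, upperPQ, Matrix.add_apply, tDt_apply]
  simp only [Fintype.sum_sum_type, Fintype.sum_prod_type]

set_option maxHeartbeats 4000000 in
/-- **`t·1 − (P + Cᵀdiag(λb)C) ⪰ 0`** (19 × 19, kernel `LDLᵀ` on the table). -/
theorem upper_ldl : PSD.LDLCert (tUQ • (1 : Matrix (Fin 19) (Fin 19) ℚ) - uplit) := by
  decide +kernel

/-- Ball tests: `0 ≤ t`, `t·ϱ ≤ c_rk`, `2ϱ ≤ γ_lo²`, `0 < ϱ`. -/
theorem ball_tests : 0 ≤ tUQ ∧ tUQ * rho2LQ ≤ cRkLQ ∧ 2 * rho2LQ ≤ gloLQ ^ 2 ∧ 0 < rho2LQ := by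
  refine ⟨by norm_num [tUQ], by norm_num [tUQ, rho2LQ, cRkLQ], by norm_num [rho2LQ, gloLQ], by norm_num [rho2LQ]⟩

/-- `|C_k|² ≤ 2` for every channel (each row of `C` has at most two entries `±1`; kernel). -/
theorem CQ_sq_le_two : ∀ k : ((Fin 10 × Fin 10) ⊕ (Fin 10 × Fin 10)), CQ k ⬝ᵥ CQ k ≤ 2 := by
  decide +kernel

/-- **The certificate's upper matrix is the cast of `upperPQ`.** -/
theorem upperMatrix_eq : lpCert.upperMatrix = upperPQ.map (Rat.cast : ℚ → ℝ) := by
  have hd : Matrix.diagonal (fun k => lpCert.lam k * lpCert.b k)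
      = (Matrix.diagonal (fun k => lamL k * bL k)).map (Rat.cast : ℚ → ℝ) := by
    rw [map_diagonal']
    congr 1; funext k
    show ((lamL k : ℚ) : ℝ) * ((bL k : ℚ) : ℝ) = _
    push_cast; rfl
  rw [LPSlabCertificate.upperMatrix, C_eq, hd, upperPQ]
  show PL.map (Rat.cast : ℚ → ℝ) + _ = _
  simp only [map_add', map_mul', map_transpose']

/-- `t·1 − upperMatrix ⪰ 0` over `ℝ`. -/
theorem upper_psd : (((tUQ : ℚ) : ℝ) • (1 : Matrix (Fin 10 ⊕ Fin 9) (Fin 10 ⊕ Fin 9) ℝ) - lpCert.upperMatrix).PosSemidef := by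
  have h := (upper_ldl.posSemidef (R := ℝ)).submatrix e1
  have e : ((tUQ • (1 : Matrix (Fin 19) (Fin 19) ℚ) - uplit).map (Rat.cast : ℚ → ℝ)).submatrix e1 e1
      = ((tUQ : ℚ) : ℝ) • (1 : Matrix (Fin 10 ⊕ Fin 9) (Fin 10 ⊕ Fin 9) ℝ) - lpCert.upperMatrix := by
    rw [upperMatrix_eq, upperPQ_eq_F]
    ext i j; by_cases hij : i = j
    · subst hij; simp
    · simp [hij, e1.injective.eq_iff]
  rwa [e] at h

/-- **The Euclidean ball `{x : xᵀx ≤ ϱ}` (Lur'e coordinates) lies inside the certified well at `2·arctan(1/100)`, level `c_rk`.**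
[cite: Khalil2002, §4.8 Theorem 4.10 (eq. (4.25)); Pai1981, §2.16 Theorem [18]] -/
theorem ball_subset_wellL :
    {x : (Fin 10 ⊕ Fin 9) → ℝ | x ⬝ᵥ x ≤ ((rho2LQ : ℚ) : ℝ)}
      ⊆ lpCert.well (fun _ => 2 * Real.arctan (1 / 100 : ℝ)) ((cRkLQ : ℚ) : ℝ) := by
  have hγ : (0 : ℝ) < 2 * Real.arctan (1 / 100 : ℝ) := by
    have := Real.arctan_pos.mpr (show (0 : ℝ) < 1 / 100 by norm_num)
    linarith
  refine lpCert.ball_subset_well (γ := fun _ => 2 * Real.arctan (1 / 100 : ℝ)) (fun _ => hγ)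
    (by exact_mod_cast ball_tests.1) upper_psd hsecL (by exact_mod_cast ball_tests.2.1) fun k => ?_
  have hC : NE39.splitLurieLinesSystem.C k = fun i => ((CQ k i : ℚ) : ℝ) := by
    rw [C_eq]; rfl
  have h1 : NE39.splitLurieLinesSystem.C k ⬝ᵥ NE39.splitLurieLinesSystem.C k = ((CQ k ⬝ᵥ CQ k : ℚ) : ℝ) := by
    rw [hC]; simp [dotProduct]
  have h2 : ((CQ k ⬝ᵥ CQ k : ℚ) : ℝ) ≤ 2 := by exact_mod_cast CQ_sq_le_two k
  have h3 : (2 : ℝ) * ((rho2LQ : ℚ) : ℝ) ≤ ((gloLQ : ℚ) : ℝ) ^ 2 := by exact_mod_cast ball_tests.2.2.1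
  have h4 : ((gloLQ : ℚ) : ℝ) ^ 2 < (2 * Real.arctan (1 / 100 : ℝ)) ^ 2 :=
    pow_lt_pow_left₀ gloLQ_lt_gamma (by exact_mod_cast gloL_test.1) two_ne_zero
  have h5 : (0 : ℝ) < ((rho2LQ : ℚ) : ℝ) := by exact_mod_cast ball_tests.2.2.2
  rw [h1]
  nlinarith

/-- **Every solution of M from the ball `{xᵀx ≤ ϱ}` of Lur'e states stays in the certified well and synchronises.**
MODELLED as model-4's record; an inner estimate for THE MODEL, not a margin of any grid.
[cite: Khalil2002, §4.8 Theorem 4.10, §7.1.2 Theorem 7.3; Pai1981, §3.6.3 eqs. (3.43)–(3.45)] -/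
theorem lossy_splitLinesLP_ball_roa {c : ℝ → ClassicalSwing.State 10} (hc : (NE39.preLossless.toModelRel (1 / 10) 0).IsSolutionOn c univ)
    (h0 : NE39.preLossless.lurieState NE39.preLossless.angleOf (c 0) ⬝ᵥ NE39.preLossless.lurieState NE39.preLossless.angleOf (c 0) ≤ ((rho2LQ : ℚ) : ℝ)) :
    (∀ t, 0 ≤ t →
        NE39.preLossless.lurieState NE39.preLossless.angleOf (c t) ∈ NE39.splitLurieLinesSystem.slab (fun _ => 2 * Real.arctan (1 / 100 : ℝ)) ∧
          lpCert.V (NE39.preLossless.lurieState NE39.preLossless.angleOf (c t)) ≤ ((cRkLQ : ℚ) : ℝ)) ∧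
      Tendsto (fun t => NE39.preLossless.lurieState NE39.preLossless.angleOf (c t)) atTop (𝓝 0) := by
  have hw := ball_subset_wellL h0
  rw [LPSlabCertificate.mem_well_iff] at hw
  exact lossy_splitLinesLP_slab_roa le_rfl hc hw.1 hw.2

end Summit.Ventures.GridStability.Bench.NE39LossySplitLinesLPRoa

end
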